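import Literature.LinearAlgebra.Alternating.WedgeWords
import Mathlib.LinearAlgebra.Matrix.Determinant.Basic
import HarnessLib

/-!
# Wedge monomials evaluate as determinants; alternation in the word

Companion of `Literature/LinearAlgebra/Alternating/WedgeWords.lean`. The value of a wedge monomial
`θ_{w 0} ∧ ⋯ ∧ θ_{w (k-1)} ∧ c` (`wedgeWord θ c k w`) on a `k`-tuple `u` is the determinant of the
pairing matrix (Warner (1983), 2.6 / Ex. 2.13: `(θ₁ ∧ ⋯ ∧ θ_k)(u₁, …, u_k) = det (θᵢ(uⱼ))`; with
Mathlib's alternatization convention — no factorials — this is an exact identity):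

* `wedgeWord_apply`: `(θ_w ∧ c)(u) = det (θ_{w i}(u j))ᵢⱼ • c(∅)` (induction = Laplace expansion
  along the first row, `Matrix.det_succ_row_zero`, against `wedgeOne_apply`);

hence the monomials are **alternating in the word**:

* `wedgeWord_comp_perm`: `θ_{w ∘ σ} ∧ c = sign σ • (θ_w ∧ c)` (`Matrix.det_permute`);
* `wedgeWord_eq_zero_of_eq`: a repeated letter kills the monomial (`Matrix.det_zero_of_row_eq`);

so that spans of monomials may be restricted to sorted injective words (the increasing `dx_I`,
`i₁ < ⋯ < i_k`, of Lange–Birkenhake (1992), Prop. 1.1.20).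

## References

* F. W. Warner, *Foundations of Differentiable Manifolds and Lie Groups* (1983), 2.6 and
  Exercise 2.13 (the determinant formula). [Warner1983]
-/

noncomputable section

open ContinuousAlternatingMap Function Matrix

namespace Literature.LinearAlgebra.Alternating

variable {𝕜 : Type*} [NontriviallyNormedField 𝕜] {𝕜' : Type*} [NormedField 𝕜']
  [NormedAlgebra 𝕜 𝕜'] {E : Type*} [NormedAddCommGroup E] [NormedSpace 𝕜 E]
  {F : Type*} [NormedAddCommGroup F] [NormedSpace 𝕜 F] [NormedSpace 𝕜' F]
  [IsScalarTower 𝕜 𝕜' F]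
  {σ : Type*} (θ : σ → (E →L[𝕜] 𝕜')) (c : E [⋀^Fin 0]→L[𝕜] F)

/-- The **pairing matrix** `(θ_{w i}(u j))ᵢⱼ` of a word and a tuple. [cite: Warner1983, 2.6] -/
def pairingMatrix {k : ℕ} (w : Fin k → σ) (u : Fin k → E) : Matrix (Fin k) (Fin k) 𝕜' :=
  Matrix.of fun i j ↦ θ (w i) (u j)

/-- Entries of the pairing matrix. [folklore] -/
@[simp] theorem pairingMatrix_apply {k : ℕ} (w : Fin k → σ) (u : Fin k → E) (i j : Fin k) :
    pairingMatrix θ w u i j = θ (w i) (u j) := rfl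

/-- Deleting the first row and the `j`-th column of the pairing matrix of `(w, u)` gives the pairing
matrix of `(tail w, removeNth j u)` (the minor of the Laplace expansion). [folklore] -/
theorem pairingMatrix_submatrix_succ {k : ℕ} (w : Fin (k + 1) → σ) (u : Fin (k + 1) → E)
    (j : Fin (k + 1)) :
    (pairingMatrix θ w u).submatrix Fin.succ j.succAbove =
      pairingMatrix θ (Fin.tail w) (j.removeNth u) := rfl

/-- A `0`-form is constant: `c u = c default`. [folklore] -/
theorem apply_fin_zero_eq (u : Fin 0 → E) : c u = c default :=
  congrArg c (Subsingleton.elim u default)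

/-- **The determinant formula** `(θ_{w 0} ∧ ⋯ ∧ θ_{w (k-1)} ∧ c)(u) = det (θ_{w i}(u j)) • c(∅)`
(Laplace expansion along the first row matches `wedgeOne_apply`). [cite: Warner1983, 2.6] -/
theorem wedgeWord_apply : ∀ (k : ℕ) (w : Fin k → σ) (u : Fin k → E),
    wedgeWord θ c k w u = (pairingMatrix θ w u).det • c default
  | 0, w, u => by rw [wedgeWord_zero, Matrix.det_fin_zero, one_smul, apply_fin_zero_eq]
  | k + 1, w, u => by
    rw [wedgeWord_succ, wedgeOne_apply, Matrix.det_succ_row_zero, Finset.sum_smul]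
    refine Finset.sum_congr rfl fun j _ ↦ ?_
    rw [wedgeWord_apply k (Fin.tail w) (j.removeNth u), pairingMatrix_submatrix_succ,
      pairingMatrix_apply, smul_smul, ← Int.cast_smul_eq_zsmul 𝕜', smul_smul, Int.cast_pow,
      Int.cast_neg, Int.cast_one, mul_assoc]

/-- **Alternation in the word**: permuting the letters multiplies the monomial by the sign of the
permutation, `θ_{w ∘ σ} ∧ c = sign σ • (θ_w ∧ c)`. [cite: Warner1983, 2.6] -/
theorem wedgeWord_comp_perm {k : ℕ} (w : Fin k → σ) (π : Equiv.Perm (Fin k)) :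
    wedgeWord θ c k (w ∘ π) = ((Equiv.Perm.sign π : ℤ) : 𝕜') • wedgeWord θ c k w := by
  ext u
  rw [wedgeWord_apply, ContinuousAlternatingMap.smul_apply, wedgeWord_apply, smul_smul]
  congr 1
  have h : pairingMatrix θ (w ∘ π) u = (pairingMatrix θ w u).submatrix π id := rfl
  rw [h, Matrix.det_permute]

/-- Swapping two letters negates the monomial. [cite: Warner1983, 2.6] -/
theorem wedgeWord_comp_swap {k : ℕ} (w : Fin k → σ) {i j : Fin k} (hij : i ≠ j) :
    wedgeWord θ c k (w ∘ Equiv.swap i j) = -wedgeWord θ c k w := by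
  rw [wedgeWord_comp_perm, Equiv.Perm.sign_swap hij]
  simp

/-- **A repeated letter kills the monomial**: `θ_w ∧ c = 0` if `w i = w j` for some `i ≠ j`
(`θ ∧ θ = 0`). [cite: Warner1983, 2.6] -/
theorem wedgeWord_eq_zero_of_eq {k : ℕ} (w : Fin k → σ) {i j : Fin k} (hij : i ≠ j)
    (h : w i = w j) : wedgeWord θ c k w = 0 := by
  ext u
  rw [wedgeWord_apply, Matrix.det_zero_of_row_eq hij (funext fun l ↦ by simp [h]), zero_smul]
  rfl

/-- Hence monomials of non-injective words vanish. [cite: Warner1983, 2.6] -/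
theorem wedgeWord_eq_zero_of_not_injective {k : ℕ} (w : Fin k → σ) (hw : ¬ Injective w) :
    wedgeWord θ c k w = 0 := by
  simp only [Injective, not_forall] at hw
  obtain ⟨i, j, h, hij⟩ := hw
  exact wedgeWord_eq_zero_of_eq θ c w hij h

/-- **Spans of monomials may be restricted to injective words.** [cite: Warner1983, 2.6] -/
theorem span_wedgeWord_eq_span_injective (k : ℕ) (S : Set (Fin k → σ)) :
    Submodule.span 𝕜' (wedgeWord θ c k '' S) =
      Submodule.span 𝕜' (wedgeWord θ c k '' {w ∈ S | Injective w}) := by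
  refine le_antisymm (Submodule.span_le.2 ?_) (Submodule.span_mono (Set.image_mono fun w hw ↦ hw.1))
  rintro _ ⟨w, hw, rfl⟩
  by_cases hinj : Injective w
  · exact Submodule.subset_span ⟨w, ⟨hw, hinj⟩, rfl⟩
  · rw [wedgeWord_eq_zero_of_not_injective θ c w hinj]
    exact Submodule.zero_mem _

/-- **The value of a monomial on a dual tuple.** If `θ_{w i}(u j) = δᵢⱼ` (e.g. `u j = v_{w j}` for a
dual pair and an injective word), then `(θ_w ∧ c)(u) = c(∅)`: the pairing matrix is the identity.
[cite: Warner1983, 2.6] -/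
theorem wedgeWord_apply_of_dual {k : ℕ} (w : Fin k → σ) (u : Fin k → E)
    (h : ∀ i j, θ (w i) (u j) = if i = j then 1 else 0) :
    wedgeWord θ c k w u = c default := by
  have hM : pairingMatrix θ w u = 1 := by
    ext i j
    rw [pairingMatrix_apply, h, Matrix.one_apply]
  rw [wedgeWord_apply, hM, Matrix.det_one, one_smul]

/-- If some letter of `w` pairs to zero with every entry of `u` (a zero row), the monomial vanishes on
`u`. [cite: Warner1983, 2.6] -/
theorem wedgeWord_apply_eq_zero_of_row {k : ℕ} (w : Fin k → σ) (u : Fin k → E) (i : Fin k)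
    (h : ∀ j, θ (w i) (u j) = 0) : wedgeWord θ c k w u = 0 := by
  have hdet : (pairingMatrix θ w u).det = 0 :=
    Matrix.det_eq_zero_of_row_eq_zero i fun j ↦ by rw [pairingMatrix_apply, h]
  rw [wedgeWord_apply, hdet, zero_smul]

end Literature.LinearAlgebra.Alternating

end
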